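import Literature.MathematicalPhysics.QuantumFieldTheory.BalabanImbrieJaffe1984to88.BIJ88Close235Proof

/-!
# `BalabanImbrieJaffe1984to88.BIJ88OpDecay230Proof` — T. Bałaban, J. Imbrie, A. Jaffe, *Effective action and cluster properties of
the abelian Higgs model*, Commun. Math. Phys. **114** (1988) 257–315 [BalabanImbrieJaffe1988]: the mechanism of p. 263 behind **(2.30)** and
**(2.31)** — the convex combination (2.27) of Neumann propagators and the cutoff (2.28)–(2.29) inherit kernel decay and closeness to
`G_k(Ω,u)`, and kernel decay gives the operator decay `|(Kf)(x)| ≦ Ce^{−c dist(suppt f,x)}‖f‖_∞` — PROVED as kernel algebra with the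
constants explicit; [6]'s propagator estimates enter as displayed kernel hypotheses

statement-level skeleton of published theorems with citation tags; proofs where landed; nothing here is a claim about the Yang–Mills mass gap

PDF held: `paper:balaban1988-cmp114-bij-abelian-higgs-effective-action` (journal page = PDF page + 256); p. 263 [PDF 7] read this session from
the text layer (`lit read … --pages 7-9`).

WHAT IS REPRODUCED.  SKELETON rows **C2.Eq2.30**, **C2.Eq2.31** (cell `lit-balaban`, HOME `run/shared/lean/pub/lit-balaban/`; Phase-2 seat
p02 gen 3 = unit `lit-balaban-p02`; C2 §§1–4 fold owner r18, referee ref-5; TAKING line HOME/STATUS.md 2026-08-21T04:43:25Z).  Before this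
file (2.30), (2.31) were the bare `def … : Prop`s `BIJ88Sect2Statements.OpDecay` / `OpClose231` (typed p239939).
p. 263, verbatim: *"Let {□_α} be the collection of (1/2L) r(e_{k−1})-cubes that can be built from cubes of size M = O(1) as in [6]. Define
G̃_k(u;x₁,x₂) = Σ_α λ_αG_k(□_α,u;x₁,x₂) (2.27) as a convex combination of Neumann propagators. The convex combination varies smoothly with
(x₁ + x₂)/2; it involves at most 2^d terms and is concentrated on □_α when (x₁ + x₂)/2 is near the center of □_α. We then put
G_{k,loc}(u;x₁,x₂) = ζ″_k(x₁,x₂)G̃_k(u;x₁,x₂), (2.28) where ζ″_k(x₁,x₂) is a smooth function of x₁ − x₂, ζ″_k(x₁,x₂) = 0, if |x₁ − x₂| ≧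
(1/4L) r(e_{k−1}), 1, if |x₁ − x₂| ≦ (1/8L) r(e_{k−1}). (2.29) The boundary conditions are always at a distance O(r(e_k)) from x₁, x₂, so a
straightforward application of the random walk expansion of [6] shows that |(G_{k,loc}(u)f)(x)| ≦ ce^{−c dist(suppt f,x)}‖f‖_∞, (2.30)
|(G_{k,loc}(u)f − G_k(Ω,u)f)(x)| ≦ e^{−cr(e_k)}e^{−c dist(suppt f,x)}‖f‖_∞, (2.31) for dist(x,Ω^c) ≧ O(r(e_k)). [Each G_k(□_α,u) is close to
G_k(Ω,u) for the relevant x₁, x₂, therefore the convex combination and G_{k,loc} are close also.]"*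

WHAT IS PROVED HERE (0 `sorry`, standard axioms; theorems only, r18's abstract real kernels `K(x,y)` with x the output and y the input point,
`dist` symmetric where a cutoff meets a decay).
§1 CONVEX COMBINATIONS ((2.27), r18's `convexComb`/`IsConvexWeights`): `abs_convexComb_le` (a pointwise majorant shared by the propagators ON
THE PAIRS WHERE THEIR WEIGHT LIVES is a majorant of the combination), `abs_convexComb_sub_le` (*"therefore the convex combination … [is]
close also"*: the same for the differences `G_k(□_α,u) − G_k(Ω,u)`).
§2 THE CUTOFF ((2.28)–(2.29), r18's `loc`/`IsCutoff`): `abs_loc_sub_le` — for `0 ≤ ζ″ ≤ 1`, `ζ″ = 1` within `R₁`,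
`|ζ″G̃ − G_Ω| ≤ |G̃ − G_Ω| + 1_{dist > R₁}|G_Ω| ≤ (ε + Ae^{−(c/2)R₁})e^{−(c/2)dist}` from `|G̃ − G_Ω| ≤ εe^{−c dist}`, `|G_Ω| ≤ Ae^{−c dist}`.
§3 KERNEL ⟹ OPERATOR (the shape of (2.30)/(2.31)): `abs_applyK_le_of_kernel` — `|K(x,y)| ≤ Ae^{−c dist(y,x)}` on the row of x and
`Σ_y e^{−(c/2)dist(y,x)} ≤ S` give `|(Kf)(x)| ≤ AS·e^{−(c/2)dist(suppt f,x)}‖f‖_∞` (r18's `applyK`/`suppDist`/`supNorm`).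
§4 **(2.30)**: `opDecay230` — from [6]'s kernel decay of each relevant `G_k(□_α,u)` (`|G_k(□_α,u;x,y)| ≤ Ae^{−c|x−y|}`, statement input
B4.Thm@573 / C2's "[6]") the two-constant operator decay of `G_{k,loc} = ζ″G̃` with `(AS, c/2)`; `opDecay230_typed`: r18's one-letter
`OpDecay dist G_{k,loc} c′` under the compatibility `AS ≤ c′ ≤ c/2` (cf. HOME/GAPS.md G-C2-p02-02).
§5 **(2.31)**: `opClose231` — from the bracketed sentence's input (each relevant `G_k(□_α,u)` within `εe^{−c dist}` of `G_k(Ω,u)` on the rows of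
the points x with `Far x`, i.e. `dist(x,Ω^c) ≧ O(r(e_k))`) and the decay of `G_k(Ω,u)`: `|(G_{k,loc}f − G_k(Ω,u)f)(x)| ≤
(ε + Ae^{−(c/2)R₁})S′·e^{−(c/4)dist(suppt f,x)}‖f‖_∞` for `Far x`; `opClose231_typed`: r18's `OpClose231 dist Far G_{k,loc} G_k(Ω,u) c′ r(e_k)`
under «r(e_k) large» `(ε + Ae^{−(c/2)R₁})S′ ≤ e^{−c′r(e_k)}`, `c′ ≤ c/4` (print: ε = e^{−cr(e_k)} from the O(r(e_k)) distance to the boundary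
conditions, R₁ = (1/8L)r(e_{k−1})).
HONEST SCOPE.  The random walk expansion of [6] itself — the kernel decay of the Neumann propagators `G_k(□_α,u)`, of `G_k(Ω,u)`, and their
closeness in the bulk — are the displayed hypotheses `hG`/`hG0`/`hclose` (statement rows of [6] = B4); the smoothness of the weights in
(x₁ + x₂)/2 and the "at most 2^d terms" play no role in these two bounds and are not used; nothing on d = 4 or the continuum; NOT summit progress.
-/

namespace Literature.MathematicalPhysics.QuantumFieldTheory.BalabanImbrieJaffe1984to88.BIJ88OpDecay230Proof

open Finset BIJ88Sect2Statements BIJ88Close235Proof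

noncomputable section

variable {α β : Type*}

/-! ## §1  Convex combinations (2.27) preserve pointwise majorants and closeness -/

/-- A majorant `B` shared at (x,y) by the propagators `G_α(x,y)` whose weight `λ_α(x,y)` is nonzero majorizes the convex combination
(2.27) at (x,y). [cite: BalabanImbrieJaffe1988, (2.27) p.263] -/
theorem abs_convexComb_le {ι : Type*} [Fintype ι] {w : ι → α → α → ℝ} (hw : IsConvexWeights w) {G : ι → α → α → ℝ}
    {x y : α} {B : ℝ} (hG : ∀ i, w i x y ≠ 0 → |G i x y| ≤ B) : |convexComb w G x y| ≤ B := by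
  have h := abs_sum_mul_le (fun i => w i x y) (fun i => G i x y) (fun i hi => hG i hi)
  have hsum : ∑ i, |w i x y| = 1 := by
    rw [← hw.2 x y]
    exact Finset.sum_congr rfl fun i _ => abs_of_nonneg (hw.1 i x y)
  simpa [convexComb, hsum] using h

/-- *"therefore the convex combination … [is] close also"*: if every propagator with nonzero weight at (x,y) is within `B` of `G_Ω(x,y)`, so is
the convex combination (the weights sum to 1). [cite: BalabanImbrieJaffe1988, (2.31) p.263] -/
theorem abs_convexComb_sub_le {ι : Type*} [Fintype ι] {w : ι → α → α → ℝ} (hw : IsConvexWeights w) {G : ι → α → α → ℝ}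
    {G₀ : α → α → ℝ} {x y : α} {B : ℝ} (hG : ∀ i, w i x y ≠ 0 → |G i x y - G₀ x y| ≤ B) :
    |convexComb w G x y - G₀ x y| ≤ B := by
  have hrw : convexComb w G x y - G₀ x y = ∑ i, w i x y * (G i x y - G₀ x y) := by
    simp only [convexComb, mul_sub, Finset.sum_sub_distrib, ← Finset.sum_mul, hw.2 x y, one_mul]
  rw [hrw]
  have h := abs_sum_mul_le (fun i => w i x y) (fun i => G i x y - G₀ x y) (fun i hi => hG i hi)
  have hsum : ∑ i, |w i x y| = 1 := by
    rw [← hw.2 x y]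
    exact Finset.sum_congr rfl fun i _ => abs_of_nonneg (hw.1 i x y)
  simpa [hsum] using h

/-! ## §2  The cutoff (2.28)–(2.29): decay kept, closeness to G_k(Ω,u) at the price of the tail of G_k(Ω,u) beyond R₁ -/

/-- A cutoff with `0 ≤ ζ ≤ 1` keeps a pointwise majorant. [cite: BalabanImbrieJaffe1988, (2.28) p.263] -/
theorem abs_loc_le {ζ K : α → β → ℝ} (h01 : ∀ a b, 0 ≤ ζ a b ∧ ζ a b ≤ 1) {a : α} {b : β} {B : ℝ} (hK : |K a b| ≤ B) :
    |loc ζ K a b| ≤ B := by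
  have hz : |ζ a b| ≤ 1 := by
    rw [abs_le]
    constructor <;> linarith [(h01 a b).1, (h01 a b).2]
  calc |loc ζ K a b| = |ζ a b| * |K a b| := abs_mul _ _
    _ ≤ 1 * |K a b| := mul_le_mul_of_nonneg_right hz (abs_nonneg _)
    _ = |K a b| := one_mul _
    _ ≤ B := hK

/-- **The bracketed sentence, kernel level**: for `0 ≤ ζ″ ≤ 1` with `ζ″ = 1` within `R₁` ((2.29)), `|G̃ − G_Ω|(x,y) ≤ εe^{−c dist}` and
`|G_Ω(x,y)| ≤ Ae^{−c dist}` give `|ζ″G̃ − G_Ω|(x,y) ≤ (ε + Ae^{−(c/2)R₁})·e^{−(c/2)dist(x,y)}` (the term `(1 − ζ″)G_Ω` lives beyond `R₁`).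
[cite: BalabanImbrieJaffe1988, (2.31) p.263] -/
theorem abs_loc_sub_le {dist : α → β → ℝ} {ζ Gt G₀ : α → β → ℝ} {R₁ R₀ ε A c : ℝ} (hc : 0 ≤ c) (hε : 0 ≤ ε) (hA : 0 ≤ A)
    (hζ : IsCutoff dist ζ R₁ R₀) (h01 : ∀ a b, 0 ≤ ζ a b ∧ ζ a b ≤ 1) (hd : ∀ a b, 0 ≤ dist a b) {a : α} {b : β}
    (hclose : |Gt a b - G₀ a b| ≤ ε * Real.exp (-c * dist a b)) (hG0 : |G₀ a b| ≤ A * Real.exp (-c * dist a b)) :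
    |loc ζ Gt a b - G₀ a b| ≤ (ε + A * Real.exp (-(c / 2) * R₁)) * Real.exp (-(c / 2) * dist a b) := by
  have hz0 := (h01 a b).1
  have hz1 := (h01 a b).2
  have hsplit : loc ζ Gt a b - G₀ a b = ζ a b * (Gt a b - G₀ a b) + (ζ a b - 1) * G₀ a b := by
    simp only [loc]
    ring
  have hhalf : Real.exp (-c * dist a b) ≤ Real.exp (-(c / 2) * dist a b) :=
    Real.exp_le_exp.2 (by nlinarith [hd a b])
  -- first piece: |ζ (G̃ − G₀)| ≤ ε e^{−c d} ≤ ε e^{−(c/2) d}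
  have h1 : |ζ a b * (Gt a b - G₀ a b)| ≤ ε * Real.exp (-(c / 2) * dist a b) := by
    rw [abs_mul, abs_of_nonneg hz0]
    calc ζ a b * |Gt a b - G₀ a b| ≤ 1 * (ε * Real.exp (-c * dist a b)) :=
          mul_le_mul hz1 hclose (abs_nonneg _) zero_le_one
      _ ≤ ε * Real.exp (-(c / 2) * dist a b) := by
          rw [one_mul]
          exact mul_le_mul_of_nonneg_left hhalf hε
  -- second piece: |(ζ − 1) G₀| ≤ 1_{d > R₁} A e^{−c d} ≤ A e^{−(c/2)R₁} e^{−(c/2) d}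
  have h2 : |(ζ a b - 1) * G₀ a b| ≤ A * Real.exp (-(c / 2) * R₁) * Real.exp (-(c / 2) * dist a b) := by
    by_cases hab : dist a b ≤ R₁
    · rw [hζ.1 a b hab, sub_self, zero_mul, abs_zero]
      positivity
    · rw [not_le] at hab
      have hz : |ζ a b - 1| ≤ 1 := by
        rw [abs_le]
        constructor <;> linarith
      calc |(ζ a b - 1) * G₀ a b| = |ζ a b - 1| * |G₀ a b| := abs_mul _ _
        _ ≤ 1 * (A * Real.exp (-c * dist a b)) := mul_le_mul hz hG0 (abs_nonneg _) zero_le_one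
        _ = A * Real.exp (-c * dist a b) := one_mul _
        _ ≤ A * Real.exp (-(c / 2) * R₁) * Real.exp (-(c / 2) * dist a b) := by
            rw [mul_assoc, ← Real.exp_add]
            refine mul_le_mul_of_nonneg_left (Real.exp_le_exp.2 ?_) hA
            nlinarith
  rw [hsplit]
  calc |ζ a b * (Gt a b - G₀ a b) + (ζ a b - 1) * G₀ a b|
      ≤ |ζ a b * (Gt a b - G₀ a b)| + |(ζ a b - 1) * G₀ a b| := abs_add_le _ _
    _ ≤ ε * Real.exp (-(c / 2) * dist a b) + A * Real.exp (-(c / 2) * R₁) * Real.exp (-(c / 2) * dist a b) :=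
        add_le_add h1 h2
    _ = (ε + A * Real.exp (-(c / 2) * R₁)) * Real.exp (-(c / 2) * dist a b) := by ring

/-! ## §3  Kernel decay ⟹ operator decay in r18's `applyK`/`suppDist`/`supNorm` vocabulary -/

/-- **Kernel ⟹ operator**: if the row of `x` satisfies `|K(x,y)| ≤ Ae^{−c dist(y,x)}` and `Σ_y e^{−(c/2)dist(y,x)} ≤ S`, then
`|(Kf)(x)| ≤ AS·e^{−(c/2)dist(suppt f,x)}‖f‖_∞` — half of the rate localizes the support, the other half pays the row sum.
[cite: BalabanImbrieJaffe1988, (2.30) p.263] -/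
theorem abs_applyK_le_of_kernel [Fintype α] {dist : α → β → ℝ} {K : β → α → ℝ} {A c S : ℝ} (hA : 0 ≤ A) (hc : 0 ≤ c)
    {x : β} (hK : ∀ y, |K x y| ≤ A * Real.exp (-c * dist y x)) (hS : ∑ y, Real.exp (-(c / 2) * dist y x) ≤ S) (f : α → ℝ) :
    |applyK K f x| ≤ A * S * Real.exp (-(c / 2) * suppDist dist f x) * supNorm f := by
  have hsN : 0 ≤ supNorm f := supNorm_nonneg f
  have hterm : ∀ y, |K x y * f y|
      ≤ A * Real.exp (-(c / 2) * suppDist dist f x) * supNorm f * Real.exp (-(c / 2) * dist y x) := by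
    intro y
    by_cases hy : f y = 0
    · rw [hy, mul_zero, abs_zero]
      positivity
    · have hsD : suppDist dist f x ≤ dist y x :=
        ciInf_le (Finite.bddBelow_range fun a : {a // f a ≠ 0} => dist a.1 x) ⟨y, hy⟩
      have hfy : |f y| ≤ supNorm f := abs_le_supNorm f y
      have hexp : Real.exp (-c * dist y x)
          ≤ Real.exp (-(c / 2) * suppDist dist f x) * Real.exp (-(c / 2) * dist y x) := by
        rw [← Real.exp_add]
        exact Real.exp_le_exp.2 (by nlinarith)
      rw [abs_mul]
      calc |K x y| * |f y| ≤ A * Real.exp (-c * dist y x) * supNorm f := mul_le_mul (hK y) hfy (abs_nonneg _) (by positivity)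
        _ ≤ A * (Real.exp (-(c / 2) * suppDist dist f x) * Real.exp (-(c / 2) * dist y x)) * supNorm f :=
            mul_le_mul_of_nonneg_right (mul_le_mul_of_nonneg_left hexp hA) hsN
        _ = A * Real.exp (-(c / 2) * suppDist dist f x) * supNorm f * Real.exp (-(c / 2) * dist y x) := by ring
  calc |applyK K f x| = |∑ y, K x y * f y| := rfl
    _ ≤ ∑ y, |K x y * f y| := Finset.abs_sum_le_sum_abs _ _
    _ ≤ ∑ y, A * Real.exp (-(c / 2) * suppDist dist f x) * supNorm f * Real.exp (-(c / 2) * dist y x) :=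
        Finset.sum_le_sum fun y _ => hterm y
    _ = A * Real.exp (-(c / 2) * suppDist dist f x) * supNorm f * ∑ y, Real.exp (-(c / 2) * dist y x) := by
        rw [Finset.mul_sum]
    _ ≤ A * Real.exp (-(c / 2) * suppDist dist f x) * supNorm f * S :=
        mul_le_mul_of_nonneg_left hS (by positivity)
    _ = A * S * Real.exp (-(c / 2) * suppDist dist f x) * supNorm f := by ring

/-- `dist(suppt f, x) ≥ 0` for a nonnegative distance (r18's `suppDist`; `0` on an empty support). [cite: BalabanImbrieJaffe1988, (2.30) p.263] -/
theorem suppDist_nonneg {dist : α → β → ℝ} (hd : ∀ a b, 0 ≤ dist a b) (f : α → ℝ) (x : β) : 0 ≤ suppDist dist f x :=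
  Real.iInf_nonneg fun a => hd a.1 x

/-! ## §4  (2.30) -/

/-- **(2.30), two explicit constants**: with `G_{k,loc} = ζ″G̃`, `G̃ = Σ_αλ_αG_k(□_α,u)` ((2.27)–(2.28)), `0 ≤ ζ″ ≤ 1`, and [6]'s kernel decay
`|G_k(□_α,u;x,y)| ≤ Ae^{−c dist(y,x)}` for every α weighted at (x,y) (symmetric `dist`, row sums `Σ_y e^{−(c/2)dist(y,x)} ≤ S`):
`|(G_{k,loc}f)(x)| ≤ AS·e^{−(c/2)dist(suppt f,x)}‖f‖_∞`. [cite: BalabanImbrieJaffe1988, (2.30) p.263] -/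
theorem opDecay230 [Fintype α] {ι : Type*} [Fintype ι] {dist : α → α → ℝ} {w : ι → α → α → ℝ} (hw : IsConvexWeights w)
    {G : ι → α → α → ℝ} {ζ : α → α → ℝ} (h01 : ∀ x y, 0 ≤ ζ x y ∧ ζ x y ≤ 1) {A c S : ℝ} (hA : 0 ≤ A) (hc : 0 ≤ c)
    (hG : ∀ i x y, w i x y ≠ 0 → |G i x y| ≤ A * Real.exp (-c * dist y x))
    (hS : ∀ x, ∑ y, Real.exp (-(c / 2) * dist y x) ≤ S) (f : α → ℝ) (x : α) :
    |applyK (loc ζ (convexComb w G)) f x| ≤ A * S * Real.exp (-(c / 2) * suppDist dist f x) * supNorm f :=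
  abs_applyK_le_of_kernel hA hc (fun y => abs_loc_le h01 (abs_convexComb_le hw fun i hi => hG i x y hi)) (hS x) f

/-- **(2.30), THE TYPED ROW** `BIJ88Sect2Statements.OpDecay dist G_{k,loc} c′` in print's one-letter shape, for any `c′` between the prefactor
and half the rate: `AS ≤ c′ ≤ c/2` (nonnegative `dist`). [cite: BalabanImbrieJaffe1988, (2.30) p.263] -/
theorem opDecay230_typed [Fintype α] {ι : Type*} [Fintype ι] {dist : α → α → ℝ} {w : ι → α → α → ℝ} (hw : IsConvexWeights w)
    {G : ι → α → α → ℝ} {ζ : α → α → ℝ} (h01 : ∀ x y, 0 ≤ ζ x y ∧ ζ x y ≤ 1) {A c S : ℝ} (hA : 0 ≤ A) (hc : 0 ≤ c)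
    (hG : ∀ i x y, w i x y ≠ 0 → |G i x y| ≤ A * Real.exp (-c * dist y x))
    (hS : ∀ x, ∑ y, Real.exp (-(c / 2) * dist y x) ≤ S) (hd : ∀ x y, 0 ≤ dist x y)
    {c' : ℝ} (hlow : A * S ≤ c') (hhigh : c' ≤ c / 2) :
    OpDecay dist (loc ζ (convexComb w G)) c' := by
  intro f x
  refine (opDecay230 hw h01 hA hc hG hS f x).trans ?_
  have hsD := suppDist_nonneg hd f x
  have hAS : 0 ≤ A * S := by
    have : (0 : ℝ) ≤ ∑ y, Real.exp (-(c / 2) * dist y x) := Finset.sum_nonneg fun y _ => (Real.exp_pos _).le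
    exact mul_nonneg hA (this.trans (hS x))
  exact mul_le_mul (mul_le_mul hlow (Real.exp_le_exp.2 (by nlinarith)) (Real.exp_pos _).le (hAS.trans hlow)) le_rfl
    (supNorm_nonneg f) (mul_nonneg (hAS.trans hlow) (Real.exp_pos _).le)

/-! ## §5  (2.31) -/

/-- **(2.31), two explicit constants**: at a point x with `Far x` (*"dist(x,Ω^c) ≧ O(r(e_k))"*), if every Neumann propagator weighted on
the row of x is within `εe^{−c dist}` of `G_k(Ω,u)` (*"Each G_k(□_α,u) is close to G_k(Ω,u) for the relevant x₁, x₂"*), `G_k(Ω,u)` decays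
with `(A, c)`, `0 ≤ ζ″ ≤ 1` with `ζ″ = 1` within `R₁`, then
`|(G_{k,loc}f − G_k(Ω,u)f)(x)| ≤ (ε + Ae^{−(c/2)R₁})S′·e^{−(c/4)dist(suppt f,x)}‖f‖_∞` (`S′` = row sum of `e^{−(c/4)dist}`).
[cite: BalabanImbrieJaffe1988, (2.31) p.263] -/
theorem opClose231 [Fintype α] {ι : Type*} [Fintype ι] {dist : α → α → ℝ} {w : ι → α → α → ℝ} (hw : IsConvexWeights w)
    {G : ι → α → α → ℝ} {G₀ ζ : α → α → ℝ} {Far : α → Prop} {R₁ R₀ ε A c S' : ℝ} (hc : 0 ≤ c) (hε : 0 ≤ ε) (hA : 0 ≤ A)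
    (hζ : IsCutoff dist ζ R₁ R₀) (h01 : ∀ x y, 0 ≤ ζ x y ∧ ζ x y ≤ 1) (hd : ∀ x y, 0 ≤ dist x y)
    (hsymm : ∀ x y, dist x y = dist y x)
    (hclose : ∀ i x y, Far x → w i x y ≠ 0 → |G i x y - G₀ x y| ≤ ε * Real.exp (-c * dist x y))
    (hG0 : ∀ x y, |G₀ x y| ≤ A * Real.exp (-c * dist x y))
    (hS' : ∀ x, ∑ y, Real.exp (-(c / 4) * dist y x) ≤ S') (f : α → ℝ) {x : α} (hx : Far x) :
    |applyK (loc ζ (convexComb w G)) f x - applyK G₀ f x|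
      ≤ (ε + A * Real.exp (-(c / 2) * R₁)) * S' * Real.exp (-(c / 4) * suppDist dist f x) * supNorm f := by
  have hsub : applyK (loc ζ (convexComb w G)) f x - applyK G₀ f x
      = applyK (fun a b => loc ζ (convexComb w G) a b - G₀ a b) f x := by
    simp only [applyK, ← Finset.sum_sub_distrib, sub_mul]
  rw [hsub]
  have hεA : 0 ≤ ε + A * Real.exp (-(c / 2) * R₁) := by positivity
  -- the row of x: |ζ″G̃ − G₀|(x,y) ≤ (ε + A e^{−(c/2)R₁}) e^{−(c/2) dist(y,x)}
  have hrow : ∀ y, |loc ζ (convexComb w G) x y - G₀ x y|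
      ≤ (ε + A * Real.exp (-(c / 2) * R₁)) * Real.exp (-(c / 2) * dist y x) := by
    intro y
    have hcl : |convexComb w G x y - G₀ x y| ≤ ε * Real.exp (-c * dist x y) :=
      abs_convexComb_sub_le hw fun i hi => hclose i x y hx hi
    have h := abs_loc_sub_le (Gt := convexComb w G) hc hε hA hζ h01 hd hcl (hG0 x y)
    rw [hsymm y x]
    exact h
  have hS2 : ∑ y, Real.exp (-(c / 2 / 2) * dist y x) ≤ S' := by
    rw [show c / 2 / 2 = c / 4 by ring]
    exact hS' x
  have key := abs_applyK_le_of_kernel (K := fun a b => loc ζ (convexComb w G) a b - G₀ a b) (c := c / 2) hεA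
    (by positivity) hrow hS2 f
  rw [show c / 2 / 2 = c / 4 by ring] at key
  exact key

/-- **(2.31), THE TYPED ROW** `BIJ88Sect2Statements.OpClose231 dist Far G_{k,loc} G_k(Ω,u) c′ r(e_k)` in print's one-letter shape, under
«r(e_k) large» absorbing the prefactor, `(ε + Ae^{−(c/2)R₁})S′ ≤ e^{−c′r(e_k)}`, and `c′ ≤ c/4` (nonnegative `dist`; print: `ε = e^{−cr(e_k)}`,
`R₁ = (1/8L)r(e_{k−1})`). [cite: BalabanImbrieJaffe1988, (2.31) p.263] -/
theorem opClose231_typed [Fintype α] {ι : Type*} [Fintype ι] {dist : α → α → ℝ} {w : ι → α → α → ℝ} (hw : IsConvexWeights w)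
    {G : ι → α → α → ℝ} {G₀ ζ : α → α → ℝ} {Far : α → Prop} {R₁ R₀ ε A c S' : ℝ} (hc : 0 ≤ c) (hε : 0 ≤ ε) (hA : 0 ≤ A)
    (hζ : IsCutoff dist ζ R₁ R₀) (h01 : ∀ x y, 0 ≤ ζ x y ∧ ζ x y ≤ 1) (hd : ∀ x y, 0 ≤ dist x y)
    (hsymm : ∀ x y, dist x y = dist y x)
    (hclose : ∀ i x y, Far x → w i x y ≠ 0 → |G i x y - G₀ x y| ≤ ε * Real.exp (-c * dist x y))
    (hG0 : ∀ x y, |G₀ x y| ≤ A * Real.exp (-c * dist x y))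
    (hS' : ∀ x, ∑ y, Real.exp (-(c / 4) * dist y x) ≤ S') {c' rek : ℝ}
    (hlarge : (ε + A * Real.exp (-(c / 2) * R₁)) * S' ≤ Real.exp (-c' * rek)) (hc' : c' ≤ c / 4) :
    OpClose231 dist Far (loc ζ (convexComb w G)) G₀ c' rek := by
  intro f x hx
  refine (opClose231 hw hc hε hA hζ h01 hd hsymm hclose hG0 hS' f hx).trans ?_
  have hsD := suppDist_nonneg hd f x
  exact mul_le_mul (mul_le_mul hlarge (Real.exp_le_exp.2 (by nlinarith)) (Real.exp_pos _).le (Real.exp_pos _).le)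
    le_rfl (supNorm_nonneg f) (mul_nonneg (Real.exp_pos _).le (Real.exp_pos _).le)

end

end Literature.MathematicalPhysics.QuantumFieldTheory.BalabanImbrieJaffe1984to88.BIJ88OpDecay230Proof
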